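import Literature.Geometry.Lorentzian.CoordCurvature
import Mathlib.Analysis.InnerProductSpace.PiL2
import HarnessLib

/-!
# Coordinate tensor calculus for diagonal metric components

Support file (everything proved, no named facts) for the explicit vacuum spacetime used in
`Literature.Geometry.Lorentzian.christodoulou_trapped_surface_formation_holds`. For metric
components on `EuclideanSpace ℝ ι` which are *diagonal* in the coordinate basis,
`G_y(v, w) = ∑ᵢ gᵢ(y) vᵢ wᵢ` (`MetricCoord.diagMetric g`), the objects of the coordinate tensor
calculus of `CoordCurvature.lean` are computed in closed form (O'Neill 1983, Ch. 3,
Prop. 3.13 and Lemma 3.38, the textbook formulas for orthogonal coordinates):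

* `MetricCoord.fderiv_diagMetric`, `fderiv_fderiv_diagMetric` — first and second derivatives;
* `MetricCoord.koszulCLM_diagMetric`, `koszulCLM_diagMetric_single` — the Koszul form
  (`2 Γ_{ij,k} = δ_{jk} ∂ᵢ gⱼ + δ_{ik} ∂ⱼ gᵢ − δ_{ij} ∂ₖ gᵢ`);
* `MetricCoord.sharpAt_diagMetric`, `ginv_diagMetric` — `gⁱʲ = δⁱʲ/gᵢ`;
* `MetricCoord.chrAt_diagMetric`, `chrAt_diagMetric_apply` — `Γ(X,Y)ₖ = K(X,Y,eₖ)/(2gₖ)`;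
* `MetricCoord.apply_chrAt_chrAt_diagMetric` — `G(Γ(X,Y), Γ(Z,W)) = ∑ₘ K(X,Y,eₘ)K(Z,W,eₘ)/(4gₘ)`;
* `MetricCoord.apply_riemAt_diagMetric` — the first-kind curvature formula with these
  ingredients, and `ricAt_diagMetric_single` — `Ric(e_b, e_d) = ∑ᵢ gᵢ⁻¹ G(R(eᵢ,e_b)e_d, eᵢ)`.

## References

* B. O'Neill, *Semi-Riemannian geometry with applications to relativity*, Academic Press 1983,
  Ch. 3, Prop. 3.13, Lemma 3.38, Lemma 3.52. [ONeill1983]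
-/

noncomputable section

set_option maxSynthPendingDepth 3

open Set Filter ContinuousLinearMap Module
open scoped Topology ContDiff

namespace Literature.Geometry.Lorentzian

namespace MetricCoord

variable {ι : Type*} [Fintype ι]

local notation "𝔼" => EuclideanSpace ℝ ι

/-! ### Diagonal bilinear forms -/

/-- The diagonal bilinear form with coefficients `c`: `(v, w) ↦ ∑ᵢ cᵢ vᵢ wᵢ`. [folklore] -/
def diagForm (c : ι → ℝ) : 𝔼 →L[ℝ] 𝔼 →L[ℝ] ℝ :=
  ∑ i, c i • (EuclideanSpace.proj i : 𝔼 →L[ℝ] ℝ).smulRight (EuclideanSpace.proj i : 𝔼 →L[ℝ] ℝ)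

/-- `diagForm c v w = ∑ᵢ cᵢ vᵢ wᵢ`. [folklore] -/
@[simp]
theorem diagForm_apply (c : ι → ℝ) (v w : 𝔼) :
    diagForm c v w = ∑ i, c i * (v i * w i) := by
  simp only [diagForm, FunLike.coe_sum, Finset.sum_apply, FunLike.coe_smul, Pi.smul_apply,
    ContinuousLinearMap.smulRight_apply, smul_eq_mul]
  refine Finset.sum_congr rfl fun i _ ↦ ?_
  simp only [PiLp.proj_apply]

/-- A diagonal form is symmetric. [folklore] -/
theorem diagForm_symm (c : ι → ℝ) (v w : 𝔼) : diagForm c v w = diagForm c w v := by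
  simp only [diagForm_apply]
  exact Finset.sum_congr rfl fun i _ ↦ by ring

/-! ### Diagonal metric components and their derivatives -/

/-- **Diagonal metric components**: `G_y(v, w) = ∑ᵢ gᵢ(y) vᵢ wᵢ` for scalar functions
`gᵢ : 𝔼 → ℝ` (a metric in orthogonal coordinates, O'Neill 1983, Ch. 3, p. 60). [cite: ONeill1983, Ch. 3, p. 60] -/
def diagMetric (g : ι → 𝔼 → ℝ) : 𝔼 → 𝔼 →L[ℝ] 𝔼 →L[ℝ] ℝ := fun y ↦ diagForm fun i ↦ g i y

-- NB: no local notation inside `variable` binders (Lean silently drops theorems using them).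
variable {g : ι → EuclideanSpace ℝ ι → ℝ} {y : EuclideanSpace ℝ ι}

/-- `diagMetric g y v w = ∑ᵢ gᵢ(y) vᵢ wᵢ`. [folklore] -/
@[simp]
theorem diagMetric_apply (g : ι → 𝔼 → ℝ) (y v w : 𝔼) :
    diagMetric g y v w = ∑ i, g i y * (v i * w i) := by
  simp [diagMetric]

/-- `diagMetric g y = diagForm (gᵢ y)`. [folklore] -/
theorem diagMetric_eq (g : ι → 𝔼 → ℝ) (y : 𝔼) : diagMetric g y = diagForm fun i ↦ g i y := rfl

/-- The derivative of diagonal components: if every `gᵢ` is differentiable at `y` then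
`DG(y)(X)(Y,Z) = ∑ᵢ Dgᵢ(y)(X) Yᵢ Zᵢ`. [folklore] -/
theorem hasFDerivAt_diagMetric (hg : ∀ i, DifferentiableAt ℝ (g i) y) :
    HasFDerivAt (diagMetric g)
      (∑ i, (fderiv ℝ (g i) y).smulRight
        ((EuclideanSpace.proj i : 𝔼 →L[ℝ] ℝ).smulRight (EuclideanSpace.proj i : 𝔼 →L[ℝ] ℝ))) y := by
  have h : diagMetric g = fun y ↦ ∑ i, g i y •
      (EuclideanSpace.proj i : 𝔼 →L[ℝ] ℝ).smulRight (EuclideanSpace.proj i : 𝔼 →L[ℝ] ℝ) := rfl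
  rw [h]
  exact HasFDerivAt.fun_sum fun i _ ↦ (hg i).hasFDerivAt.smul_const _

/-- `DG(y)(X)(Y,Z) = ∑ᵢ Dgᵢ(y)(X) Yᵢ Zᵢ`. [folklore] -/
theorem fderiv_diagMetric (hg : ∀ i, DifferentiableAt ℝ (g i) y) (X Y Z : 𝔼) :
    fderiv ℝ (diagMetric g) y X Y Z = ∑ i, fderiv ℝ (g i) y X * (Y i * Z i) := by
  rw [(hasFDerivAt_diagMetric hg).fderiv]
  simp only [FunLike.coe_sum, Finset.sum_apply, ContinuousLinearMap.smulRight_apply,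
    FunLike.coe_smul, Pi.smul_apply, smul_eq_mul]
  refine Finset.sum_congr rfl fun i _ ↦ ?_
  simp [mul_comm]

/-- Differentiability of diagonal components. [folklore] -/
theorem differentiableAt_diagMetric (hg : ∀ i, DifferentiableAt ℝ (g i) y) :
    DifferentiableAt ℝ (diagMetric g) y :=
  (hasFDerivAt_diagMetric hg).differentiableAt

/-- Smoothness of diagonal components on an open set. [folklore] -/
theorem contDiffOn_diagMetric {V : Set 𝔼} {n : ℕ∞ω} (hg : ∀ i, ContDiffOn ℝ n (g i) V) :
    ContDiffOn ℝ n (diagMetric g) V := by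
  have h : diagMetric g = fun y ↦ ∑ i, g i y •
      (EuclideanSpace.proj i : 𝔼 →L[ℝ] ℝ).smulRight (EuclideanSpace.proj i : 𝔼 →L[ℝ] ℝ) := rfl
  rw [h]
  exact ContDiffOn.sum fun i _ ↦ (hg i).smul contDiffOn_const

/-- The components `y ↦ G_y(Y,Z)` as an explicit scalar function. [folklore] -/
theorem diagMetric_apply_eq_sum (g : ι → 𝔼 → ℝ) (Y Z : 𝔼) :
    (fun y ↦ diagMetric g y Y Z) = fun y ↦ ∑ i, g i y * (Y i * Z i) := by
  funext y; exact diagMetric_apply g y Y Z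

/-- **Second derivatives of diagonal components**: on an open set `V` where the `gᵢ` are `C²`,
`D²G(y)(X)(W)(Y,Z) = ∑ᵢ ∂_X ∂_W gᵢ (y) Yᵢ Zᵢ` with `∂_X ∂_W gᵢ (y) = D(D gᵢ(·)(W))(y)(X)`.
[folklore] -/
theorem fderiv_fderiv_diagMetric {V : Set 𝔼} (hG : IsMetricOn (diagMetric g) V) (hy : y ∈ V)
    (hg : ∀ i, ContDiffOn ℝ ∞ (g i) V) (X W Y Z : 𝔼) :
    fderiv ℝ (fderiv ℝ (diagMetric g)) y X W Y Z =
      ∑ i, fderiv ℝ (fun z ↦ fderiv ℝ (g i) z W) y X * (Y i * Z i) := by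
  rw [← hG.fderiv_fderiv_apply₃ hy]
  -- near `y`, `z ↦ DG(z)(W)(Y,Z)` is the explicit sum
  have hmem : ∀ᶠ z in 𝓝 y, z ∈ V := hG.eventually_mem hy
  have hdiff : ∀ z ∈ V, ∀ i, DifferentiableAt ℝ (g i) z := fun z hz i ↦
    ((hg i).contDiffAt (hG.isOpen.mem_nhds hz)).differentiableAt (by simp)
  have heq : (fun z ↦ fderiv ℝ (diagMetric g) z W Y Z) =ᶠ[𝓝 y]
      fun z ↦ ∑ i, fderiv ℝ (g i) z W * (Y i * Z i) :=
    hmem.mono fun z hz ↦ fderiv_diagMetric (hdiff z hz) W Y Z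
  rw [heq.fderiv_eq]
  have hd2 : ∀ i, DifferentiableAt ℝ (fun z ↦ fderiv ℝ (g i) z W) y := by
    intro i
    have h1 : ContDiffAt ℝ ∞ (fderiv ℝ (g i)) y :=
      (((hg i).fderiv_of_isOpen hG.isOpen (by simp)) y hy).contDiffAt (hG.isOpen.mem_nhds hy)
    exact differentiableAt_clm_apply_const (h1.differentiableAt (by simp)) W
  have hd3 : ∀ i, DifferentiableAt ℝ (fun z ↦ fderiv ℝ (g i) z W * (Y i * Z i)) y :=
    fun i ↦ (hd2 i).mul_const _
  rw [fderiv_fun_sum fun i _ ↦ hd3 i]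
  simp only [FunLike.coe_sum, Finset.sum_apply]
  refine Finset.sum_congr rfl fun i _ ↦ ?_
  rw [fderiv_mul_const (hd2 i)]
  simp [smul_eq_mul, mul_comm]

/-! ### Coordinate vectors -/

section Basis

variable [DecidableEq ι]

/-- The coordinate vector `eᵢ` of `EuclideanSpace ℝ ι`. [folklore] -/
abbrev eb (i : ι) : 𝔼 := EuclideanSpace.single i (1 : ℝ)

omit [Fintype ι] in
/-- Components of the coordinate vectors. [folklore] -/
@[simp]
theorem eb_apply (i j : ι) : (eb i : 𝔼) j = if j = i then 1 else 0 := by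
  simp [eb, PiLp.single_apply]

/-- `diagForm c (e i) w = cᵢ wᵢ`. [folklore] -/
@[simp]
theorem diagForm_eb_left (c : ι → ℝ) (i : ι) (w : 𝔼) : diagForm c (eb i) w = c i * w i := by
  rw [diagForm_apply]
  rw [Finset.sum_eq_single i]
  · simp
  · intro j _ hji
    simp [hji]
  · intro h; exact absurd (Finset.mem_univ i) h

/-- `diagForm c v (e i) = cᵢ vᵢ`. [folklore] -/
@[simp]
theorem diagForm_eb_right (c : ι → ℝ) (v : 𝔼) (i : ι) : diagForm c v (eb i) = c i * v i := by
  rw [diagForm_symm, diagForm_eb_left]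

/-- A diagonal form with nonvanishing coefficients is invertible (nondegenerate). [folklore] -/
theorem isInvertible_diagForm {c : ι → ℝ} (hc : ∀ i, c i ≠ 0) : (diagForm c).IsInvertible := by
  refine isInvertible_of_nondegenerate fun v hv ↦ ?_
  ext i
  have h := hv (eb i)
  rw [diagForm_eb_right] at h
  simpa [hc i] using h

/-- `G_y(eᵢ, w) = gᵢ(y) wᵢ`. [folklore] -/
theorem diagMetric_eb_left (g : ι → 𝔼 → ℝ) (y : 𝔼) (i : ι) (w : 𝔼) :
    diagMetric g y (eb i) w = g i y * w i := by
  rw [diagMetric_eq, diagForm_eb_left]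

/-- `G_y(v, eᵢ) = gᵢ(y) vᵢ`. [folklore] -/
theorem diagMetric_eb_right (g : ι → 𝔼 → ℝ) (y v : 𝔼) (i : ι) :
    diagMetric g y v (eb i) = g i y * v i := by
  rw [diagMetric_eq, diagForm_eb_right]

/-- `G_y(eᵢ, eⱼ) = δᵢⱼ gᵢ(y)`. [folklore] -/
theorem diagMetric_eb_eb (g : ι → 𝔼 → ℝ) (y : 𝔼) (i j : ι) :
    diagMetric g y (eb i) (eb j) = if i = j then g i y else 0 := by
  rw [diagMetric_eb_left, eb_apply]
  split_ifs with h
  · subst h; simp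
  · simp

/-- **Diagonal components with smooth nonvanishing entries on an open set are metric
components** (`IsMetricOn`). [cite: ONeill1983, Ch. 3, Def. 3.1] -/
theorem isMetricOn_diagMetric {V : Set 𝔼} (hV : IsOpen V) (hg : ∀ i, ContDiffOn ℝ ∞ (g i) V)
    (hne : ∀ i, ∀ y ∈ V, g i y ≠ 0) : IsMetricOn (diagMetric g) V where
  isOpen := hV
  contDiffOn := contDiffOn_diagMetric hg
  symm _ _ v w := diagForm_symm _ v w
  isInvertible y hy := isInvertible_diagForm fun i ↦ hne i y hy

/-! ### Koszul form, index raising and the Christoffel map -/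

omit [DecidableEq ι] in
/-- **The Koszul form of diagonal components**:
`K(X,Y,Z) = ∑ᵢ (∂_X gᵢ Yᵢ Zᵢ + ∂_Y gᵢ Zᵢ Xᵢ − ∂_Z gᵢ Xᵢ Yᵢ)`. [cite: ONeill1983, Ch. 3, Prop. 3.13] -/
theorem koszulCLM_diagMetric (hg : ∀ i, DifferentiableAt ℝ (g i) y) (X Y Z : 𝔼) :
    koszulCLM (diagMetric g) y X Y Z =
      ∑ i, (fderiv ℝ (g i) y X * (Y i * Z i) + fderiv ℝ (g i) y Y * (Z i * X i)
        - fderiv ℝ (g i) y Z * (X i * Y i)) := by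
  rw [koszulCLM_apply, fderiv_diagMetric hg, fderiv_diagMetric hg, fderiv_diagMetric hg,
    ← Finset.sum_add_distrib, ← Finset.sum_sub_distrib]

/-- **The Koszul form on coordinate vectors** (twice the Christoffel symbols of the first kind
of an orthogonal metric): `K(e_b, e_c, e_d) = δ_{cd} ∂_b g_c + δ_{bd} ∂_c g_b − δ_{bc} ∂_d g_b`.
[cite: ONeill1983, Ch. 3, Prop. 3.13] -/
theorem koszulCLM_diagMetric_single (hg : ∀ i, DifferentiableAt ℝ (g i) y) (b c d : ι) :
    koszulCLM (diagMetric g) y (eb b) (eb c) (eb d) =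
      (if c = d then fderiv ℝ (g c) y (eb b) else 0)
        + (if b = d then fderiv ℝ (g b) y (eb c) else 0)
        - (if b = c then fderiv ℝ (g b) y (eb d) else 0) := by
  rw [koszulCLM_diagMetric hg, Finset.sum_sub_distrib, Finset.sum_add_distrib]
  congr 2
  · by_cases h : c = d
    · subst h
      rw [if_pos rfl, Finset.sum_eq_single c]
      · simp
      · intro j _ hj; simp [hj]
      · intro h; exact absurd (Finset.mem_univ c) h
    · rw [if_neg h]
      refine Finset.sum_eq_zero fun i _ ↦ ?_
      by_cases hic : i = c
      · subst hic; simp [h]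
      · simp [hic]
  · by_cases h : b = d
    · subst h
      rw [if_pos rfl, Finset.sum_eq_single b]
      · simp
      · intro j _ hj; simp [hj]
      · intro h; exact absurd (Finset.mem_univ b) h
    · rw [if_neg h]
      refine Finset.sum_eq_zero fun i _ ↦ ?_
      by_cases hid : i = d
      · subst hid; simp [Ne.symm h]
      · simp [hid]
  · by_cases h : b = c
    · subst h
      rw [if_pos rfl, Finset.sum_eq_single b]
      · simp
      · intro j _ hj; simp [hj]
      · intro h; exact absurd (Finset.mem_univ b) h
    · rw [if_neg h]
      refine Finset.sum_eq_zero fun i _ ↦ ?_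
      by_cases hib : i = b
      · subst hib; simp [h]
      · simp [hib]

/-- **Index raising for diagonal components**: `♯α = ∑ᵢ (α(eᵢ)/gᵢ) eᵢ`. [cite: ONeill1983, Ch. 3, p. 60] -/
theorem sharpAt_diagMetric (hne : ∀ i, g i y ≠ 0) (α : 𝔼 →L[ℝ] ℝ) :
    sharpAt (diagMetric g) y α = ∑ i, (α (eb i) / g i y) • (eb i : 𝔼) := by
  have hinv : (diagMetric g y).IsInvertible := isInvertible_diagForm hne
  refine sharpAt_eq_of_forall hinv fun w ↦ ?_
  rw [map_sum, FunLike.coe_sum, Finset.sum_apply]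
  simp only [map_smul, FunLike.coe_smul, Pi.smul_apply, smul_eq_mul,
    diagMetric_eb_left]
  have hw : α w = ∑ i, w i * α (eb i) := by
    conv_lhs => rw [← (EuclideanSpace.basisFun ι ℝ).toBasis.sum_repr w]
    rw [map_sum]
    refine Finset.sum_congr rfl fun i _ ↦ ?_
    rw [map_smul, smul_eq_mul, OrthonormalBasis.coe_toBasis_repr_apply, EuclideanSpace.basisFun_repr,
      OrthonormalBasis.coe_toBasis, EuclideanSpace.basisFun_apply]
  rw [hw]
  refine Finset.sum_congr rfl fun i _ ↦ ?_
  field_simp [hne i]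

/-- The components of `♯α`: `(♯α)ₖ = α(eₖ)/gₖ`. [cite: ONeill1983, Ch. 3, p. 60] -/
theorem sharpAt_diagMetric_apply (hne : ∀ i, g i y ≠ 0) (α : 𝔼 →L[ℝ] ℝ) (k : ι) :
    sharpAt (diagMetric g) y α k = α (eb k) / g k y := by
  rw [sharpAt_diagMetric hne]
  rw [WithLp.ofLp_sum, Finset.sum_apply, Finset.sum_eq_single k]
  · simp
  · intro j _ hj
    simp [Ne.symm hj]
  · intro h; exact absurd (Finset.mem_univ k) h

/-- **Inverse metric coefficients of diagonal components** in the coordinate basis: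
`gⁱʲ = δⁱʲ / gᵢ`. [cite: ONeill1983, Ch. 3, p. 60] -/
theorem ginv_diagMetric (hne : ∀ i, g i y ≠ 0) (i j : ι) :
    ginv (diagMetric g) (EuclideanSpace.basisFun ι ℝ).toBasis y i j = if i = j then (g i y)⁻¹ else 0 := by
  rw [ginv]
  have hc : coordCLM (EuclideanSpace.basisFun ι ℝ).toBasis j = (EuclideanSpace.proj j : 𝔼 →L[ℝ] ℝ) := by
    ext v
    simp [coordCLM_apply]
  rw [hc]
  have : (EuclideanSpace.basisFun ι ℝ).toBasis.coord i
      (sharpAt (diagMetric g) y (EuclideanSpace.proj j : 𝔼 →L[ℝ] ℝ)) =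
      sharpAt (diagMetric g) y (EuclideanSpace.proj j : 𝔼 →L[ℝ] ℝ) i := by
    simp
  rw [this, sharpAt_diagMetric_apply hne]
  by_cases h : i = j
  · subst h; simp
  · rw [if_neg h]
    simp [h]

/-- **The Christoffel map of diagonal components**: `Γ(X,Y) = ∑ₖ (K(X,Y,eₖ)/(2gₖ)) eₖ`, i.e.
`Γᵏᵢⱼ = K(eᵢ,eⱼ,eₖ)/(2gₖ)` (no summation). [cite: ONeill1983, Ch. 3, Prop. 3.13] -/
theorem chrAt_diagMetric (hne : ∀ i, g i y ≠ 0) (X Y : 𝔼) :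
    chrAt (diagMetric g) y X Y =
      ∑ k, (koszulCLM (diagMetric g) y X Y (eb k) / (2 * g k y)) • (eb k : 𝔼) := by
  rw [chrAt_apply, sharpAt_diagMetric hne, Finset.smul_sum]
  refine Finset.sum_congr rfl fun k _ ↦ ?_
  rw [smul_smul]
  congr 1
  field_simp

/-- The components of the Christoffel map: `Γ(X,Y)ₖ = K(X,Y,eₖ)/(2gₖ)`. [cite: ONeill1983, Ch. 3, Prop. 3.13] -/
theorem chrAt_diagMetric_apply (hne : ∀ i, g i y ≠ 0) (X Y : 𝔼) (k : ι) :
    chrAt (diagMetric g) y X Y k = koszulCLM (diagMetric g) y X Y (eb k) / (2 * g k y) := by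
  rw [chrAt_diagMetric hne, WithLp.ofLp_sum, Finset.sum_apply, Finset.sum_eq_single k]
  · simp
  · intro j _ hj
    simp [Ne.symm hj]
  · intro h; exact absurd (Finset.mem_univ k) h

/-- **Metric pairing of two Christoffel vectors**:
`G(Γ(X,Y), Γ(Z,W)) = ∑ₘ K(X,Y,eₘ) K(Z,W,eₘ) / (4 gₘ)`. [cite: ONeill1983, Ch. 3, Prop. 3.13] -/
theorem apply_chrAt_chrAt_diagMetric (hne : ∀ i, g i y ≠ 0) (X Y Z W : 𝔼) :
    diagMetric g y (chrAt (diagMetric g) y X Y) (chrAt (diagMetric g) y Z W) =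
      ∑ m, koszulCLM (diagMetric g) y X Y (eb m) * koszulCLM (diagMetric g) y Z W (eb m)
        / (4 * g m y) := by
  rw [diagMetric_apply]
  refine Finset.sum_congr rfl fun m _ ↦ ?_
  rw [chrAt_diagMetric_apply hne, chrAt_diagMetric_apply hne]
  field_simp [hne m]
  ring

/-! ### Curvature -/

/-- **The curvature of diagonal components in first-kind form**:
`G(R(X,Y)Z, W) = ½ (∂_X K(Y,Z,W) − ∂_Y K(X,Z,W)) − ∑ₘ K(Y,Z,eₘ)K(X,W,eₘ)/(4gₘ)
  + ∑ₘ K(X,Z,eₘ)K(Y,W,eₘ)/(4gₘ)` (O'Neill 1983, Ch. 3, Lemma 3.38 for orthogonal coordinates).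
[cite: ONeill1983, Ch. 3, Lemma 3.38] -/
theorem apply_riemAt_diagMetric {V : Set 𝔼} (hG : IsMetricOn (diagMetric g) V) (hy : y ∈ V)
    (X Y Z W : 𝔼) :
    diagMetric g y (riemAt (diagMetric g) y X Y Z) W =
      2⁻¹ * (fderiv ℝ (fun z ↦ koszulCLM (diagMetric g) z Y Z W) y X
        - fderiv ℝ (fun z ↦ koszulCLM (diagMetric g) z X Z W) y Y)
        - ∑ m, koszulCLM (diagMetric g) y Y Z (eb m) * koszulCLM (diagMetric g) y X W (eb m)
            / (4 * g m y)
        + ∑ m, koszulCLM (diagMetric g) y X Z (eb m) * koszulCLM (diagMetric g) y Y W (eb m)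
            / (4 * g m y) := by
  have hne : ∀ i, g i y ≠ 0 := by
    intro i hi
    have hinv := hG.isInvertible y hy
    -- `G_y(eᵢ, ·) = gᵢ eᵢ* = 0` contradicts invertibility
    have h0 : diagMetric g y (eb i) = 0 := by
      ext w
      rw [diagMetric_eb_left, hi, zero_mul]; rfl
    have := hinv.injective (a₁ := eb i) (a₂ := 0) (by rw [h0, map_zero])
    have h1 : (eb i : 𝔼) i = (0 : 𝔼) i := by rw [this]
    simp at h1
  rw [hG.apply_riemAt hy, apply_chrAt_chrAt_diagMetric hne, apply_chrAt_chrAt_diagMetric hne]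

/-- Every entry of metric components is nonzero at the points of `V`. [folklore] -/
theorem ne_zero_of_isMetricOn {V : Set 𝔼} (hG : IsMetricOn (diagMetric g) V) (hy : y ∈ V)
    (i : ι) : g i y ≠ 0 := by
  intro hi
  have hinv := hG.isInvertible y hy
  have h0 : diagMetric g y (eb i) = 0 := by
    ext w
    rw [diagMetric_eb_left, hi, zero_mul]; rfl
  have := hinv.injective (a₁ := eb i) (a₂ := 0) (by rw [h0, map_zero])
  have h1 : (eb i : 𝔼) i = (0 : 𝔼) i := by rw [this]
  simp at h1

/-- **The Ricci form of diagonal components on coordinate vectors**: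
`Ric(Y, Z) = ∑ᵢ gᵢ⁻¹ G(R(eᵢ, Y)Z, eᵢ)` (O'Neill 1983, Ch. 3, Lemma 3.52, `Ric = g^{ij} R_{i··j}`
with diagonal `g^{ij}`). [cite: ONeill1983, Ch. 3, Lemma 3.52] -/
theorem ricAt_diagMetric {V : Set 𝔼} (hG : IsMetricOn (diagMetric g) V) (hy : y ∈ V)
    (Y Z : 𝔼) :
    ricAt (diagMetric g) y Y Z =
      ∑ i, (g i y)⁻¹ * diagMetric g y (riemAt (diagMetric g) y (eb i) Y Z) (eb i) := by
  have hne := ne_zero_of_isMetricOn hG hy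
  rw [ricAt_eq_sum_ginv (EuclideanSpace.basisFun ι ℝ).toBasis (hG.isInvertible y hy)]
  refine Finset.sum_congr rfl fun i _ ↦ ?_
  rw [Finset.sum_eq_single i]
  · rw [ginv_diagMetric hne, if_pos rfl, OrthonormalBasis.coe_toBasis, EuclideanSpace.basisFun_apply]
  · intro j _ hj
    rw [ginv_diagMetric hne, if_neg (Ne.symm hj), zero_mul]
  · intro h; exact absurd (Finset.mem_univ i) h

/-- The paired curvature component `G(R(eᵢ,Y)Z, eᵢ)` equals `gᵢ · (R(eᵢ,Y)Z)ᵢ`. [folklore] -/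
theorem apply_riemAt_eb (Y Z : 𝔼) (i : ι) :
    diagMetric g y (riemAt (diagMetric g) y (eb i) Y Z) (eb i) =
      g i y * riemAt (diagMetric g) y (eb i) Y Z i := by
  rw [diagMetric_eb_right]

/-! ### Everything on coordinate vectors: Kronecker form of the Koszul symbols -/

omit [Fintype ι] in
/-- The **Kronecker form** of the Koszul symbols of an orthogonal metric: for a table
`d : ι → ι → ℝ` of first partials `d i b = ∂_b gᵢ` (or of second partials `∂_a ∂_b gᵢ` at fixed
`a`), `kd d b c e = δ_{ce} d c b + δ_{be} d b c − δ_{bc} d b e`. [cite: ONeill1983, Ch. 3, Prop. 3.13] -/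
def kd (d : ι → ι → ℝ) (b c e : ι) : ℝ :=
  (if c = e then d c b else 0) + (if b = e then d b c else 0) - (if b = c then d b e else 0)

/-- The Koszul form on coordinate vectors in Kronecker form, with `d i b = ∂_b gᵢ (y)`.
[cite: ONeill1983, Ch. 3, Prop. 3.13] -/
theorem koszulCLM_diagMetric_eb (hg : ∀ i, DifferentiableAt ℝ (g i) y) (b c e : ι) :
    koszulCLM (diagMetric g) y (eb b) (eb c) (eb e) =
      kd (fun i a ↦ fderiv ℝ (g i) y (eb a)) b c e := by
  rw [koszulCLM_diagMetric_single hg, kd]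

/-- **The derivative of the Koszul symbols** along `eₐ`, in Kronecker form with the second
partials `d i b = ∂_a ∂_b gᵢ (y) = D(Dgᵢ(·)(e_b))(y)(eₐ)` (on an open set where the `gᵢ` are
smooth). [cite: ONeill1983, Ch. 3, Lemma 3.38] -/
theorem fderiv_koszulCLM_diagMetric_eb {V : Set 𝔼} (hV : IsOpen V)
    (hg : ∀ i, ContDiffOn ℝ ∞ (g i) V) (hy : y ∈ V) (a b c e : ι) :
    fderiv ℝ (fun z ↦ koszulCLM (diagMetric g) z (eb b) (eb c) (eb e)) y (eb a) =
      kd (fun i b' ↦ fderiv ℝ (fun z ↦ fderiv ℝ (g i) z (eb b')) y (eb a)) b c e := by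
  have hdiff : ∀ z ∈ V, ∀ i, DifferentiableAt ℝ (g i) z := fun z hz i ↦
    ((hg i).contDiffAt (hV.mem_nhds hz)).differentiableAt (by simp)
  -- the second partials exist
  have hd2 : ∀ i (b' : ι), DifferentiableAt ℝ (fun z ↦ fderiv ℝ (g i) z (eb b')) y := by
    intro i b'
    have h1 : ContDiffAt ℝ ∞ (fderiv ℝ (g i)) y :=
      (((hg i).fderiv_of_isOpen hV (by simp)) y hy).contDiffAt (hV.mem_nhds hy)
    exact differentiableAt_clm_apply_const (h1.differentiableAt (by simp)) (eb b')
  -- near `y` the symbol is the Kronecker combination of first partials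
  have heq : (fun z ↦ koszulCLM (diagMetric g) z (eb b) (eb c) (eb e)) =ᶠ[𝓝 y]
      fun z ↦ (if c = e then (1 : ℝ) else 0) * fderiv ℝ (g c) z (eb b)
        + (if b = e then (1 : ℝ) else 0) * fderiv ℝ (g b) z (eb c)
        - (if b = c then (1 : ℝ) else 0) * fderiv ℝ (g b) z (eb e) := by
    filter_upwards [hV.mem_nhds hy] with z hz
    rw [koszulCLM_diagMetric_single (hdiff z hz)]
    split_ifs <;> simp
  have hF : HasFDerivAt (fun z ↦ (if c = e then (1 : ℝ) else 0) * fderiv ℝ (g c) z (eb b)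
        + (if b = e then (1 : ℝ) else 0) * fderiv ℝ (g b) z (eb c)
        - (if b = c then (1 : ℝ) else 0) * fderiv ℝ (g b) z (eb e))
      ((if c = e then (1 : ℝ) else 0) • fderiv ℝ (fun z ↦ fderiv ℝ (g c) z (eb b)) y
        + (if b = e then (1 : ℝ) else 0) • fderiv ℝ (fun z ↦ fderiv ℝ (g b) z (eb c)) y
        - (if b = c then (1 : ℝ) else 0) • fderiv ℝ (fun z ↦ fderiv ℝ (g b) z (eb e)) y) y :=
    (((hd2 c b).hasFDerivAt.const_mul _).add ((hd2 b c).hasFDerivAt.const_mul _)).sub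
      ((hd2 b e).hasFDerivAt.const_mul _)
  rw [heq.fderiv_eq, hF.fderiv]
  simp only [_root_.sub_apply, _root_.add_apply, FunLike.coe_smul, Pi.smul_apply,
    smul_eq_mul, kd]
  split_ifs <;> simp

/-- **The curvature of an orthogonal metric on coordinate vectors** (O'Neill 1983, Ch. 3,
Lemma 3.38 in first-kind form): with the first partials `d₁ i b = ∂_b gᵢ` and the second partials
`d₂ a i b = ∂_a ∂_b gᵢ` at `y`,
`G(R(eₐ,e_b)e_c, e_e) = ½ (kd (d₂ a) b c e − kd (d₂ b) a c e)
  − ∑ₘ kd d₁ b c m · kd d₁ a e m /(4gₘ) + ∑ₘ kd d₁ a c m · kd d₁ b e m /(4gₘ)`.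
[cite: ONeill1983, Ch. 3, Lemma 3.38] -/
theorem apply_riemAt_diagMetric_eb {V : Set 𝔼} (hV : IsOpen V)
    (hg : ∀ i, ContDiffOn ℝ ∞ (g i) V) (hne : ∀ i, ∀ z ∈ V, g i z ≠ 0) (hy : y ∈ V)
    (a b c e : ι) :
    diagMetric g y (riemAt (diagMetric g) y (eb a) (eb b) (eb c)) (eb e) =
      2⁻¹ * (kd (fun i b' ↦ fderiv ℝ (fun z ↦ fderiv ℝ (g i) z (eb b')) y (eb a)) b c e
          - kd (fun i b' ↦ fderiv ℝ (fun z ↦ fderiv ℝ (g i) z (eb b')) y (eb b)) a c e)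
        - ∑ m, kd (fun i a' ↦ fderiv ℝ (g i) y (eb a')) b c m
            * kd (fun i a' ↦ fderiv ℝ (g i) y (eb a')) a e m / (4 * g m y)
        + ∑ m, kd (fun i a' ↦ fderiv ℝ (g i) y (eb a')) a c m
            * kd (fun i a' ↦ fderiv ℝ (g i) y (eb a')) b e m / (4 * g m y) := by
  have hG : IsMetricOn (diagMetric g) V := isMetricOn_diagMetric hV hg hne
  have hdiff : ∀ i, DifferentiableAt ℝ (g i) y := fun i ↦
    ((hg i).contDiffAt (hV.mem_nhds hy)).differentiableAt (by simp)
  rw [apply_riemAt_diagMetric hG hy, fderiv_koszulCLM_diagMetric_eb hV hg hy,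
    fderiv_koszulCLM_diagMetric_eb hV hg hy]
  simp only [koszulCLM_diagMetric_eb hdiff]

/-- **The Ricci tensor of an orthogonal metric on coordinate vectors**:
`Ric(e_b, e_c) = ∑ₐ gₐ⁻¹ G(R(eₐ, e_b)e_c, eₐ)` with the curvature components of
`apply_riemAt_diagMetric_eb`. [cite: ONeill1983, Ch. 3, Lemma 3.52] -/
theorem ricAt_diagMetric_eb {V : Set 𝔼} (hV : IsOpen V)
    (hg : ∀ i, ContDiffOn ℝ ∞ (g i) V) (hne : ∀ i, ∀ z ∈ V, g i z ≠ 0) (hy : y ∈ V) (b c : ι) :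
    ricAt (diagMetric g) y (eb b) (eb c) =
      ∑ a, (g a y)⁻¹ *
        (2⁻¹ * (kd (fun i b' ↦ fderiv ℝ (fun z ↦ fderiv ℝ (g i) z (eb b')) y (eb a)) b c a
            - kd (fun i b' ↦ fderiv ℝ (fun z ↦ fderiv ℝ (g i) z (eb b')) y (eb b)) a c a)
          - ∑ m, kd (fun i a' ↦ fderiv ℝ (g i) y (eb a')) b c m
              * kd (fun i a' ↦ fderiv ℝ (g i) y (eb a')) a a m / (4 * g m y)
          + ∑ m, kd (fun i a' ↦ fderiv ℝ (g i) y (eb a')) a c m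
              * kd (fun i a' ↦ fderiv ℝ (g i) y (eb a')) b a m / (4 * g m y)) := by
  have hG : IsMetricOn (diagMetric g) V := isMetricOn_diagMetric hV hg hne
  rw [ricAt_diagMetric hG hy]
  refine Finset.sum_congr rfl fun a _ ↦ ?_
  rw [apply_riemAt_diagMetric_eb hV hg hne hy]

end Basis

end MetricCoord

end Literature.Geometry.Lorentzian
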